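import Literature.AlgebraicGeometry.Motives.IntegralModelReductionMap
import Literature.AlgebraicGeometry.Morphisms.EtaleNearOfFormallyUnramifiedStalk
import Literature.AlgebraicGeometry.Morphisms.UnramifiedStalkOfFiber
import HarnessLib

/-!
# Γ3-E1a: a flat, finitely presented morphism of integral models whose SPECIAL FIBRE is an open immersion near `z` is ÉTALE near `z`
# ([StacksProject 02G8, 02GU]; [EGAIV4] 17.4.1, 17.6.1; [Liu2021] Prop. D.8 (2) is the source of the hypothesis)

Topic `Literature/AlgebraicGeometry/Motives`, namespace `Literature.AlgebraicGeometry.Motives(.IntegralModel)`.  PROOF FILE (theorems only; no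
definition, no named fact, no instance, no `sorry`).  Cell `hodgecm-mathlib` (D-0151), FLOOR 0, programme F0P5a (D9op road 2′, crux item
stmt-HodgeConjecture-24832), (γ3-generic) row **Γ3-E1a** (F0P5a-plan (g2) desk `Gamma3-DESK.v0.2`: :124
`EtaleNearOfFlatOfSpecialFibreOpenImmersion`, sub-letters :141 Γ3-E1a-i ★ p801384 `Morphisms/EtaleNearOfFormallyUnramifiedStalk`, :160 Γ3-E1a-ii),
the D1-currency assembly over the two GENERIC files ★ `Morphisms/EtaleNearOfFormallyUnramifiedStalk` (stalk ⇒ étale near the point) and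
`Morphisms/UnramifiedStalkOfFiber` (fibre ⇒ stalk; descent through a base change).

SETTING (tree D1 currency, ★ `Motives/IntegralModelReductionMap` ∕ ★ `DiophantineGeometry/AbelianSchemeModelSpecialFibre`): `K` a number field,
`v` a finite place, `𝒮`, `𝒯` integral models over `𝓞_{K,v}` of `K`-schemes `X`, `T` (`IntegralModel`), `π : 𝒯.total ⟶ 𝒮.total` an
`𝓞_{K,v}`-morphism, `πᵥ := ((specialFibreFunctor v).map π).left : 𝒯ᵥ → 𝒮ᵥ` its special fibre (`specialFibreFunctor v = Over.pullback` along
`specResidueField v : Spec κ(v) → Spec 𝓞_{K,v}`), `ι_𝒯 := pullback.fst 𝒯.total.hom (specResidueField v) : 𝒯ᵥ ↪ 𝒯` (a closed immersion),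
`z` a `κ̄(v)`-point of `𝒯ᵥ` with underlying point `z₀ ∈ V` for an open `V ⊆ 𝒯ᵥ` on which `πᵥ` is an OPEN IMMERSION.

* §1 `isPullback_overPullback_map_left` — for ANY base change functor `Over.pullback i` and Over-morphism `π`: the square
  `X ×_S T → Y ×_S T` over `π.left` with the first projections is cartesian (transitivity of fibre products); `IntegralModel.isPullback_specialFibreFunctor_map`
  — the special fibre `πᵥ` sits in the cartesian square `IsPullback ι_𝒯 πᵥ π.left ι_𝒮`; `IntegralModel.isClosedImmersion_specialFibre_fst` — `ι_𝒯` is a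
  closed immersion (`residueAt v` is surjective).
* §2 **`IntegralModel.formallyUnramified_stalkMap_of_isOpenImmersion_specialFibre`** (Γ3-E1a-ii, with the binder `[LocallyOfFiniteType π.left]` the
  letter needs — see the file docstring of ★ `UnramifiedStalkOfFiber`): the stalk map of `π` at `ι_𝒯 z₀` is formally unramified.  PROOF: `V = ι_𝒯⁻¹ O`
  for an open `O ⊆ 𝒯` (closed immersions are embeddings); `(ι_𝒯⁻¹ O ↪ 𝒯ᵥ) ≫ πᵥ = V ↪ 𝒯ᵥ → 𝒮ᵥ` is an open immersion, hence formally unramified;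
  ★ `formallyUnramified_stalkMap_of_isPullback_of_opens` (the fibre of `π` through `ι_𝒯 z₀` is, after the faithfully flat residue-field
  extension, the fibre of `πᵥ|_V` through `z₀` — fpqc descent — and the pointwise fibre criterion [StacksProject 02G8]).
* §3 **`IntegralModel.exists_etale_of_isOpenImmersion_specialFibre`** (Γ3-E1a = desk :124 without its idle `IsProper` binders): for `π` FLAT and
  locally of finite presentation there is an open `U ∋ ι_𝒯 z₀` of `𝒯` with `Etale (U.ι ≫ π.left)` (§2 + ★ p801384
  `exists_etale_of_formallyUnramified_stalkMap`).  In [Liu2021] Prop. D.8 (2) `V = T⁺ ∖ T⁻` and `πᵥ|_{T⁺}` is an isomorphism; the output is the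
  binder `(U) [Etale (U.ι ≫ π.left)]` of Γ3-E1 `FibreCountOneOfEtaleNear`.

HC_CM is proved only modulo the 7 printed citations until rung 0 closes; nothing of [Liu2021] is asserted here.  Ours (formalisation glue);
axioms `propext`, `Classical.choice`, `Quot.sound`.

## References
* [StacksProject] The Stacks Project, Tag 02G8 (unramified: fibrewise ∕ pointwise), Tag 02GU (étale at a point, openness), Tag 08WD.
* [EGAIV4] A. Grothendieck, J. Dieudonné, EGA IV₄ (Publ. Math. IHÉS 32, 1967), Thm. 17.4.1, Thm. 17.6.1.
* [Liu2021] Y. Liu, *Fourier–Jacobi cycles and arithmetic relative trace formula*, Camb. J. Math. 9 (2021) = arXiv:2102.11518, Prop. D.8 (2)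
  (FJcycle.tex l. 5522–5540).
-/

set_option autoImplicit false

noncomputable section

open CategoryTheory CategoryTheory.Limits TopologicalSpace AlgebraicGeometry IsDedekindDomain IsDedekindDomain.HeightOneSpectrum IsLocalRing
open scoped NumberField
open Literature.NumberTheory.DiophantineGeometry

namespace Literature.AlgebraicGeometry.Motives

universe u

/-! ## §1 The special fibre of a model morphism sits in a cartesian square over it -/

/-- **Base change of an `S`-morphism is cartesian over it** (transitivity of fibre products): for `i : T ⟶ S` and a morphism `π : X ⟶ Y` of
`S`-schemes, the square formed by `((Over.pullback i).map π).left : X ×_S T → Y ×_S T`, `π.left`, and the first projections is a pull-back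
square.  (Twin of ★ `Morphisms.isPullback_pullback_map_base`, stated for `Over.pullback`.) [cite: StacksProject, Tag 02G8] -/
theorem isPullback_overPullback_map_left {S T : Scheme.{u}} (i : T ⟶ S) {X Y : Over S} (π : X ⟶ Y) :
    IsPullback (pullback.fst X.hom i) ((Over.pullback i).map π).left π.left (pullback.fst Y.hom i) := by
  have e1 : ((Over.pullback i).map π).left ≫ pullback.snd Y.hom i = pullback.snd X.hom i := by
    simp only [Over.pullback_map_left]
    exact pullback.lift_snd _ _ _
  have e2 : ((Over.pullback i).map π).left ≫ pullback.fst Y.hom i = pullback.fst X.hom i ≫ π.left := by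
    simp only [Over.pullback_map_left]
    exact pullback.lift_fst _ _ _
  refine (IsPullback.of_right (h₁₁ := ((Over.pullback i).map π).left) (h₁₂ := pullback.snd Y.hom i)
    (v₁₁ := pullback.fst X.hom i) (v₁₂ := pullback.fst Y.hom i) (v₁₃ := i) (h₂₁ := π.left) (h₂₂ := Y.hom)
    ?_ e2 (IsPullback.of_hasPullback Y.hom i).flip).flip
  rw [e1, Over.w π]
  exact (IsPullback.of_hasPullback X.hom i).flip

namespace IntegralModel

variable {K : Type} [Field K] [NumberField K] {v : HeightOneSpectrum (𝓞 K)} {X T : SchemeOver K}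

/-- **The special fibre `πᵥ` of a model morphism `π : 𝒯 ⟶ 𝒮` sits in the cartesian square `𝒯ᵥ = 𝒯 ×_𝒮 𝒮ᵥ` over `π`** (with the closed
immersions `ι_𝒯 = pullback.fst 𝒯.hom ι`, `ι_𝒮` of the special fibres). [cite: StacksProject, Tag 02G8] -/
theorem isPullback_specialFibreFunctor_map (𝒮 : IntegralModel (valuationSubringAtPrime K v) K X)
    (𝒯 : IntegralModel (valuationSubringAtPrime K v) K T) (π : 𝒯.total ⟶ 𝒮.total) :
    IsPullback (pullback.fst 𝒯.total.hom (specResidueField v)) ((specialFibreFunctor v).map π).left π.left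
      (pullback.fst 𝒮.total.hom (specResidueField v)) :=
  isPullback_overPullback_map_left (specResidueField v) π

/-- The inclusion `ι_𝒯 : 𝒯ᵥ ↪ 𝒯` of the special fibre is a CLOSED IMMERSION (base change of `Spec κ(v) ↪ Spec 𝓞_{K,v}`, the reduction map
`𝓞_{K,v} → κ(v)` being surjective). [cite: StacksProject, Tag 02G8] -/
theorem isClosedImmersion_specialFibre_fst (𝒯 : IntegralModel (valuationSubringAtPrime K v) K T) :
    IsClosedImmersion (pullback.fst 𝒯.total.hom (specResidueField v)) := by
  haveI : IsClosedImmersion (specResidueField v) := IsClosedImmersion.spec_of_surjective _ (residueAt_surjective v)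
  exact MorphismProperty.pullback_fst (P := @IsClosedImmersion) _ _ inferInstance

/-! ## §2 Γ3-E1a-ii: open immersion on the special fibre near `z` ⇒ the stalk map of `π` at `z` is formally unramified -/

/-- **Γ3-E1a-ii.**  Let `π : 𝒯 ⟶ 𝒮` be a morphism of integral models at `v`, locally of finite type, whose special fibre `πᵥ : 𝒯ᵥ → 𝒮ᵥ` restricted
to an open `V ⊆ 𝒯ᵥ` is an OPEN IMMERSION, and `z` a geometric point of `𝒯ᵥ` whose underlying point `z₀` lies in `V`.  Then the stalk map
`𝒪_{𝒮, π(ι_𝒯 z₀)} → 𝒪_{𝒯, ι_𝒯 z₀}` of `π` at the point `ι_𝒯 z₀` of the total space is formally unramified.  (`V = ι_𝒯⁻¹ O` for an open `O` of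
`𝒯` since `ι_𝒯` is an embedding; `(ι_𝒯⁻¹ O ↪ 𝒯ᵥ) ≫ πᵥ` is an open immersion, so formally unramified; the cartesian square of §1 and ★
`Morphisms.formallyUnramified_stalkMap_of_isPullback_of_opens` — fpqc descent of the fibre through `z₀` plus the pointwise fibre criterion.)
The finite-type binder is necessary (without it `𝔪_p 𝒪_{𝒯,t} = 𝔪_t` and `κ(t) = κ(p)` do not give `Ω = 0`).
[cite: StacksProject, Tag 02G8] [cite: EGAIV4, Thm. 17.4.1] [cite: Liu2021, Prop. D.8 (2) (FJcycle.tex l. 5522–5540)] -/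
theorem formallyUnramified_stalkMap_of_isOpenImmersion_specialFibre (𝒮 : IntegralModel (valuationSubringAtPrime K v) K X)
    (𝒯 : IntegralModel (valuationSubringAtPrime K v) K T) (π : 𝒯.total ⟶ 𝒮.total) [LocallyOfFiniteType π.left]
    (V : (𝒯.reductionAt).left.Opens) [IsOpenImmersion (V.ι ≫ ((specialFibreFunctor v).map π).left)]
    (z : AlgPoints 𝒯.reductionAt (geomResidueField v)) (hzV : z.toSpecHom.base (closedPoint (geomResidueField v)) ∈ V) :
    (π.left.stalkMap
      ((z.toSpecHom ≫ pullback.fst 𝒯.total.hom (specResidueField v)).base (closedPoint (geomResidueField v)))).hom.FormallyUnramified := by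
  -- the closed immersion `ι_𝒯 : 𝒯ᵥ ↪ 𝒯`, typed on `𝒯.reductionAt` (= `(specialFibreFunctor v).obj 𝒯.total` by `rfl`)
  let ιT : 𝒯.reductionAt.left ⟶ 𝒯.total.left := pullback.fst 𝒯.total.hom (specResidueField v)
  have hsq : IsPullback ιT ((specialFibreFunctor v).map π).left π.left (pullback.fst 𝒮.total.hom (specResidueField v)) :=
    isPullback_specialFibreFunctor_map 𝒮 𝒯 π
  -- the hypothesis, as formal unramifiedness (an open immersion is étale)
  have hE : Etale (V.ι ≫ ((specialFibreFunctor v).map π).left) := inferInstance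
  -- `V = ι_𝒯 ⁻¹ O` for an open `O ⊆ 𝒯` (a closed immersion is an embedding)
  haveI : IsClosedImmersion ιT := isClosedImmersion_specialFibre_fst 𝒯
  obtain ⟨O, hO, hOV⟩ := ιT.isClosedEmbedding.isInducing.isOpen_iff.mp V.isOpen
  let O' : 𝒯.total.left.Opens := ⟨O, hO⟩
  have hV : ιT ⁻¹ᵁ O' = V := TopologicalSpace.Opens.ext hOV
  haveI : FormallyUnramified ((ιT ⁻¹ᵁ O').ι ≫ ((specialFibreFunctor v).map π).left) := by
    rw [hV]
    exact (Etale.iff_flat_and_formallyUnramified.mp hE).2.1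
  have hz : z.toSpecHom.base (closedPoint (geomResidueField v)) ∈ ιT ⁻¹ᵁ O' := by
    rw [hV]
    exact hzV
  exact Literature.AlgebraicGeometry.Morphisms.formallyUnramified_stalkMap_of_isPullback_of_opens π.left hsq O' _ hz

/-! ## §3 Γ3-E1a: étale near `z` -/

/-- **Γ3-E1a — a FLAT, finitely presented model morphism whose special fibre is an open immersion near `z` is ÉTALE on an open
neighbourhood of `z` in the total space**: `∃ U ∋ ι_𝒯 z₀` open in `𝒯` with `Etale (U.ι ≫ π.left)` (§2 + ★ `exists_etale_of_formallyUnramified_stalkMap`: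
flat + lfp + formally unramified stalk ⇒ étale nearby, [StacksProject 02GU, 08WD]).  In [Liu2021] Prop. D.8 (2): `V = T⁺ ∖ T⁻`, `πᵥ|_{T⁺}` an
isomorphism; the output is the `(U) [Etale (U.ι ≫ π.left)]` binder of Γ3-E1.  (The desk letter :124 carries two further, idle, `IsProper` binders.)
[cite: StacksProject, Tag 02GU and Tag 08WD] [cite: EGAIV4, Thm. 17.6.1] [cite: Liu2021, Prop. D.8 (2) (FJcycle.tex l. 5522–5540)] -/
theorem exists_etale_of_isOpenImmersion_specialFibre (𝒮 : IntegralModel (valuationSubringAtPrime K v) K X)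
    (𝒯 : IntegralModel (valuationSubringAtPrime K v) K T) (π : 𝒯.total ⟶ 𝒮.total) [Flat π.left] [LocallyOfFinitePresentation π.left]
    (V : (𝒯.reductionAt).left.Opens) [IsOpenImmersion (V.ι ≫ ((specialFibreFunctor v).map π).left)]
    (z : AlgPoints 𝒯.reductionAt (geomResidueField v)) (hzV : z.toSpecHom.base (closedPoint (geomResidueField v)) ∈ V) :
    ∃ U : (𝒯.total).left.Opens,
      (z.toSpecHom ≫ pullback.fst 𝒯.total.hom (specResidueField v)).base (closedPoint (geomResidueField v)) ∈ U ∧ Etale (U.ι ≫ π.left) :=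
  Literature.AlgebraicGeometry.Morphisms.exists_etale_of_formallyUnramified_stalkMap π.left _
    (formallyUnramified_stalkMap_of_isOpenImmersion_specialFibre 𝒮 𝒯 π V z hzV)

/-- The same with the desk՚s `IsProper` binders in place (letter `EtaleNearOfFlatOfSpecialFibreOpenImmersion`, `Gamma3-DESK.v0.2` :124, VERBATIM shape).
[cite: StacksProject, Tag 02GU] [cite: Liu2021, Prop. D.8 (2) (FJcycle.tex l. 5522–5540)] -/
theorem exists_etale_of_isOpenImmersion_specialFibre' (𝒮 : IntegralModel (valuationSubringAtPrime K v) K X)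
    (𝒯 : IntegralModel (valuationSubringAtPrime K v) K T) [IsProper 𝒮.total.hom] [IsProper 𝒯.total.hom] (π : 𝒯.total ⟶ 𝒮.total)
    [Flat π.left] [LocallyOfFinitePresentation π.left]
    (V : (𝒯.reductionAt).left.Opens) [IsOpenImmersion (V.ι ≫ ((specialFibreFunctor v).map π).left)]
    (z : AlgPoints 𝒯.reductionAt (geomResidueField v)) (hzV : z.toSpecHom.base (closedPoint (geomResidueField v)) ∈ V) :
    ∃ U : (𝒯.total).left.Opens,
      (z.toSpecHom ≫ pullback.fst 𝒯.total.hom (specResidueField v)).base (closedPoint (geomResidueField v)) ∈ U ∧ Etale (U.ι ≫ π.left) :=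
  exists_etale_of_isOpenImmersion_specialFibre 𝒮 𝒯 π V z hzV

end IntegralModel

end Literature.AlgebraicGeometry.Motives

end
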